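import Literature.NumberTheory.LFunctions.RudnickSarnak
import Literature.NumberTheory.LFunctions.ZetaArgVariation
import HarnessLib

/-!
# Rudnick–Sarnak Theorem 3.2 for `ζ`: proved levels of `RSUnrestrictedLimits`

Proofs only (no definitions, no named facts). Companion of `RudnickSarnak.lean`, towards the
discharge of the named fact `Literature.NumberTheory.LFunctions.rudnick_sarnak_unrestricted`
(Z. Rudnick, P. Sarnak, *Zeros of principal `L`-functions and random matrix theory*, Duke Math.
J. **81** (1996), 269–322, **Theorem 3.2** for `m = 1`): under RH, for every admissible `Φ` at
level `n = k + 1`, `C_n(f_Φ, T)/N(T) → ∫ Φ C_O` (`RSUnrestrictedLimits`).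

This file records the levels that are theorems of the tree:

* `rsUnrestrictedLimits_zero` — level `n = 1` (`k = 0`), unconditionally: `f_Φ ≡ Φ(0)` (the
  hyperplane `∑ ξ_j = 0` of `ℝ¹` is a point), so `C_1(f_Φ, T) = N(T) Φ(0)`, while
  `∫ Φ C_O = Φ(0)` (`rsPairingFunctional_one`: only the empty matching); and `N(T) ≥ 1`
  eventually (`tendsto_zetaZeroCount_atTop_holds`, Riemann–von Mangoldt).

The general level is RS §3 (Prop. 2.1, Lemmas 3.1–3.10, (3.71)–(3.77)) and is not proved here;
level `n = 2` is Montgomery's pair correlation theorem (RS §1, Remark after Thm. 1.2), proved in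
the tree as `montgomery_pair_correlation_restricted_holds` in Montgomery's normalisation.

## References

* Z. Rudnick, P. Sarnak, Duke Math. J. 81 (1996): (3.2), (3.6), (3.9), Thm. 3.2 (p. 285).
* E. C. Titchmarsh, *The Theory of the Riemann Zeta-Function* (1986), Thm. 9.4.
-/

noncomputable section

open Filter MeasureTheory Complex Finset
open scoped Real Topology

namespace Literature.NumberTheory.LFunctions

namespace RudnickSarnak

/-- At level `n = 1` (`k = 0`) the test function `f_Φ` of (3.6) is the constant `Φ(0)`: the
hyperplane `ξ_0 = -∑_{i ≥ 1} ξ_i` of `ℝ¹` is the point `0`, and the integral over the one-point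
space `Fin 0 → ℝ` (a Dirac mass) of `Φ(0) · e(0)` is `Φ(0)`. [cite: RudnickSarnak1996, (3.6)] -/
theorem rsPhiTest_zero_apply (Φ : (Fin 1 → ℝ) → ℂ) (x : Fin 1 → ℝ) : rsPhiTest Φ x = Φ 0 := by
  unfold rsPhiTest
  have hvol : (volume : Measure (Fin 0 → ℝ)) = Measure.dirac (fun i ↦ isEmptyElim i) := by
    rw [volume_pi]
    exact Measure.pi_of_empty _ _
  rw [hvol, integral_dirac]
  have h0 : (Fin.cons (-∑ i : Fin 0, (fun i ↦ isEmptyElim i : Fin 0 → ℝ) i)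
      (fun i ↦ isEmptyElim i) : Fin 1 → ℝ) = 0 := by
    funext i
    rw [Fin.fin_one_eq_zero i]
    simp
  rw [h0]
  simp

/-- At level `1` the unrestricted sum (3.2) of `f_Φ` over the first `N` ordinates is `N · Φ(0)`
(`N` index tuples `Fin 1 → Fin N`, constant summand). [cite: RudnickSarnak1996, (3.2)] -/
theorem unrestrictedLevelSum_one_rsPhiTest (Φ : (Fin 1 → ℝ) → ℂ) (N : ℕ) :
    unrestrictedLevelSum 1 (rsPhiTest Φ) N = N * Φ 0 := by
  unfold unrestrictedLevelSum
  simp only [rsPhiTest_zero_apply, sum_const, card_univ, nsmul_eq_mul]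
  simp

end RudnickSarnak

/-- **RS Theorem 3.2 for `ζ` at level `n = 1`** (the case `k = 0` of `RSUnrestrictedLimits`;
no hypothesis on `Φ` and no RH needed at this level): `C_1(f_Φ, T)/N(T) = Φ(0) = ∫ Φ C_O` as
soon as `N(T) ≥ 1`, since `f_Φ ≡ Φ(0)` (`RudnickSarnak.rsPhiTest_zero_apply`) and (3.9) has only
the empty matching at level one (`rsPairingFunctional_one`); `N(T) → ∞` by Riemann–von Mangoldt
(`tendsto_zetaZeroCount_atTop_holds`). [cite: RudnickSarnak1996, Thm 3.2] -/
theorem rsUnrestrictedLimits_zero (Φ : (Fin 1 → ℝ) → ℂ) :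
    Tendsto (fun T : ℝ ↦ unrestrictedLevelSum 1 (rsPhiTest Φ) (zetaZeroCount T) /
      zetaZeroCount T) atTop (𝓝 (rsPairingFunctional 1 Φ)) := by
  rw [rsPairingFunctional_one]
  refine (tendsto_const_nhds (x := Φ 0)).congr' ?_
  filter_upwards [tendsto_zetaZeroCount_atTop_holds.eventually_ge_atTop 1] with T hT
  rw [RudnickSarnak.unrestrictedLevelSum_one_rsPhiTest]
  have hN : ((zetaZeroCount T : ℕ) : ℂ) ≠ 0 := by
    exact_mod_cast (Nat.one_le_iff_ne_zero.1 hT)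
  field_simp

end Literature.NumberTheory.LFunctions

end
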